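import Literature.Analysis.FluidPDE.Tao2016AveragedNS.NegativeKick
import Literature.Analysis.FluidPDE.Tao2016AveragedNS.SeedCancellation
import Mathlib.Analysis.SpecialFunctions.Gaussian.GaussianIntegral
import Mathlib.Analysis.Real.Pi.Bounds
import HarnessLib

/-!
# The negative-kick dud, sharp form: `2/√M` seeds stall Tao's delay gate (Tao 2016, §5.5)

HONEST FRAMING (cell `pub-fluidc`): low prior, high value-of-information experiment on Tao's
machine paradigm; NOT a claim that NS blows up.

NegativeKick.lean exhibits, by the intermediate value theorem over the EXACT flow of a member
`delayCircuitWith K M ε`, a negative pre-load `κ* < 3ε²e^{-M}` (three seeds) on the trigger whose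
flow line returns the trigger to zero at the end of the cycle and never fires (`|ã| ≤ 6e^{-M}` on
`[0,2]`). Here the endpoint estimate is sharpened by a GAUSSIAN bound on the discounted seed
integral: on `[0,1]` the clock of such a trajectory runs at rate `≥ (49/50)ε`, so the integrating
factor obeys `e^{-G(u)} ≤ e^{-(49/100)Mu²}` and
`∫₀² ε²e^{-M}a²e^{-G} ≤ ε²e^{-M}(√(π/((49/100)M))/2 + e^{1/20-(49/100)M}) ≤ (7/4)ε²e^{-M}/√M`
(`integral_gaussian_Ioi`). Hence (§1–§2) the cycle-end trigger is already negative at pre-load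
`-2ε²e^{-M}/√M`, and the dud needs only `2/√M` seeds — `2K⁻⁵` seeds on Tao's `M = K¹⁰`
(`exists_negativeKick_dud_sharp`, `datum_radius_lt_sharp`).

§3 records the cell's question (D)(4) at the SEED scale (`PseudoOrbitTransitionSeed q`: forcing
budget `ε²e^{-M}/K^q`; SeedCancellation.lean decided the `ε²/K^q` version in the negative for every
`q` by cancelling the seed with forcing) and decides it for `q ≤ 4` in the negative — with NO forcing
at all (`δ = 0`): the dud datum is `2K⁻⁵ ≤ K^{-q}` seeds from (5.6). The cell's numerics (job
j054490) locate the dud at `≈ 1.2533K⁻⁵` seeds (`√(π/2M)` seeds), ABOVE the `q = 5` budget of `K⁻⁵`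
seeds by the factor `1.25`: so this witness does not reach `q = 5`, which is expected to HOLD
(tightly — a pre-load of `0.8` critical merely re-times the gate by `O(1/M)`), and `q ≥ 5` is the
live positive half; nothing about `q ≥ 5` is decided here.
-/

namespace Literature.Analysis.FluidPDE.Tao2016AveragedNS

open Real Set MeasureTheory NegKick
open scoped NNReal

variable {K M ε κ : ℝ} {X : ℝ → Fin 5 → ℝ}

/-! ## §1. The IVT step and the datum radius for a general negative endpoint -/

/-- **IVT step.** If the cycle-end trigger is negative at some pre-load `κ₁ ∈ [0, 3ε²e^{-M}]`, then
some pre-load `κ* ∈ (0, κ₁)` returns the trigger to zero exactly at the end of the cycle, and along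
that EXACT flow line `-3ε²e^{-M} ≤ c ≤ 0` and `|d|, |ã| ≤ 6e^{-M}` on `[0,2]`.
[cite: Tao2016AveragedNS, Theorem 5.3] -/
theorem exists_dud_of_cycleEndTrigger_neg (hK : 2 * 20 ^ 42 * (Nat.factorial 42 : ℝ) + 16 ≤ K)
    (hML : 3000 * Real.log K ≤ M) (hMK : M ≤ K ^ 10) (hε : 0 < ε)
    (hεle : ε ≤ exp (-(10 * M)) / K ^ 100) {κ₁ : ℝ} (hκ₁0 : 0 ≤ κ₁)
    (hκ₁ : κ₁ ≤ 3 * (ε ^ 2 * exp (-M))) (hneg : cycleEndTrigger K M ε κ₁ < 0) :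
    ∃ κ : ℝ, 0 < κ ∧ κ < κ₁ ∧
      delayFlowWith K M ε 2 (kickInit (-κ)) 2 = 0 ∧
      ∀ t ∈ Icc (0 : ℝ) 2,
        delayFlowWith K M ε t (kickInit (-κ)) 2 ≤ 0 ∧
        -(3 * (ε ^ 2 * exp (-M))) ≤ delayFlowWith K M ε t (kickInit (-κ)) 2 ∧
        |delayFlowWith K M ε t (kickInit (-κ)) 3| ≤ 6 * exp (-M) ∧
        |delayFlowWith K M ε t (kickInit (-κ)) 4| ≤ 6 * exp (-M) := by
  obtain ⟨hK16, hM4, hε1, hs3, hsmall, hexpM⟩ := negKick_params hK hML hMK hε hεle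
  have hM : 0 ≤ M := by linarith
  have hs : 0 < ε ^ 2 * exp (-M) := by positivity
  set s₃ : ℝ := 3 * (ε ^ 2 * exp (-M)) with hs₃
  -- IVT on [0, κ₁]
  have hcont : ContinuousOn (cycleEndTrigger K M ε) (Icc 0 κ₁) :=
    (continuousOn_cycleEndTrigger K M ε).mono (Icc_subset_Icc le_rfl (by linarith))
  have hIVT := intermediate_value_Icc' hκ₁0 hcont
  have h0 : 0 ≤ cycleEndTrigger K M ε 0 := cycleEndTrigger_zero_nonneg K M ε
  obtain ⟨κ, ⟨hκ0, hκκ₁⟩, hroot⟩ := hIVT ⟨hneg.le, h0⟩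
  have hκ3 : κ ≤ s₃ := hκκ₁.trans hκ₁
  -- the trajectory at the root
  set X : ℝ → Fin 5 → ℝ := fun σ => delayFlowWith K M ε σ (kickInit (-κ)) with hXdef
  have hX : ∀ t, HasDerivAt X (delayCircuitWith K M ε (X t)) t := hasDerivAt_delayFlowWith K M ε _
  have hX0 : X 0 = kickInit (-κ) := delayFlowWith_zero K M ε _
  have hκsq : (-κ) ^ 2 ≤ 1 := by rw [neg_sq]; nlinarith
  obtain ⟨hc5, hb, -⟩ := negKick_trajectory hK hML hMK hε hεle hX hX0 hκ0 hκ3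
  have h2 : X 2 2 = 0 := by simpa [cycleEndTrigger, hXdef] using hroot
  have hf := floor_factor_le (M := M) hε hsmall
  have htrap : ∀ t ∈ Icc (0 : ℝ) 2, X t 2 ≤ 0 ∧ -s₃ ≤ X t 2 := fun t ht => by
    obtain ⟨hl, hu⟩ := c_trapped hX hX0 hκsq hM hε (β := 50 * M * ε ^ 3 * exp (2 * M)) hb h2 ht
    refine ⟨hu, le_trans ?_ hl⟩
    have h22 : ε ^ 2 * exp (-M) * (2 - t) * exp (2 * (ε⁻¹ * M * (50 * M * ε ^ 3 * exp (2 * M))))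
        ≤ ε ^ 2 * exp (-M) * 2 * (11 / 10) := by
      have ha : ε ^ 2 * exp (-M) * (2 - t) ≤ ε ^ 2 * exp (-M) * 2 := by nlinarith [ht.1]
      exact mul_le_mul ha hf (exp_pos _).le (by positivity)
    rw [hs₃]; linarith
  have habs : ∀ t ∈ Icc (0 : ℝ) 2, |X t 2| ≤ s₃ := fun t ht => by
    obtain ⟨hu, hl⟩ := htrap t ht
    rw [abs_le]; exact ⟨hl, by linarith⟩
  have hde : ∀ t ∈ Icc (0 : ℝ) 2, |X t 3| ≤ 6 * exp (-M) ∧ |X t 4| ≤ 6 * exp (-M) := fun t ht => by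
    obtain ⟨hd, he⟩ := de_le hX hX0 hκsq hε (by positivity) habs ht
    have hC : (ε ^ 2)⁻¹ * s₃ * t ≤ 6 * exp (-M) := by
      have : (ε ^ 2)⁻¹ * s₃ = 3 * exp (-M) := by rw [hs₃]; field_simp
      rw [this]; nlinarith [ht.2, exp_pos (-M)]
    exact ⟨hd.trans hC, he.trans hC⟩
  -- κ > 0: at κ = 0 the member fires (Theorem 5.3 for the family), contradicting |ã(2)| ≤ 6e^{-M}
  have hκpos : 0 < κ := by
    rcases hκ0.lt_or_eq with h | h
    · exact h
    · exfalso
      have hK0 : 0 < K := by linarith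
      have hfire := (delayFlowWith_kickInit_fires hK hML hMK hε hεle le_rfl
        (kickToleranceWith_pos hK0 hε).le (σ := 2) le_rfl).1
      have hdud := (hde 2 (right_mem_Icc.2 (by norm_num))).2
      have hX2 : X 2 4 = delayFlowWith K M ε 2 (kickInit 0) 4 := by simp [hXdef, ← h]
      rw [hX2] at hdud
      have hK10 : 200 / K ^ 10 ≤ 1 / 4 := by
        rw [div_le_iff₀ (by positivity)]
        have : (16 : ℝ) ^ 10 ≤ K ^ 10 := pow_le_pow_left₀ (by norm_num) hK16 10
        nlinarith
      have h1 := (abs_sub_le_iff.1 hfire).2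
      have h2 := (abs_le.1 hdud).2
      linarith
  have hκlt : κ < κ₁ := by
    rcases hκκ₁.lt_or_eq with h | h
    · exact h
    · exfalso; rw [h] at hroot; linarith
  refine ⟨κ, hκpos, hκlt, h2, fun t ht => ⟨(htrap t ht).1, (htrap t ht).2, hde t ht⟩⟩

/-- If the cycle-end trigger is negative at a pre-load `κ₁ ≤ 3ε²e^{-M}`, no firing guarantee at
the end of the cycle can cover all energy-one data within sup-distance `κ₁` of (5.6).
[cite: Tao2016AveragedNS, Theorem 5.3] -/
theorem datum_radius_lt_of_cycleEndTrigger_neg (hK : 2 * 20 ^ 42 * (Nat.factorial 42 : ℝ) + 16 ≤ K)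
    (hML : 3000 * Real.log K ≤ M) (hMK : M ≤ K ^ 10) (hε : 0 < ε)
    (hεle : ε ≤ exp (-(10 * M)) / K ^ 100) {κ₁ : ℝ} (hκ₁0 : 0 ≤ κ₁)
    (hκ₁ : κ₁ ≤ 3 * (ε ^ 2 * exp (-M))) (hneg : cycleEndTrigger K M ε κ₁ < 0) {r : ℝ}
    (h : ∀ p : Fin 5 → ℝ, energy p = 1 → ‖p - delayInit‖ ≤ r →
      |delayFlowWith K M ε 2 p 4 - 1| ≤ 1 / 2) :
    r < κ₁ := by
  obtain ⟨-, -, -, hs3, -, hexpM⟩ := negKick_params hK hML hMK hε hεle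
  obtain ⟨κ, hκ0, hκlt, -, hdud⟩ :=
    exists_dud_of_cycleEndTrigger_neg hK hML hMK hε hεle hκ₁0 hκ₁ hneg
  by_contra hr
  have hr' : κ₁ ≤ r := le_of_not_gt hr
  have hκ1 : κ ≤ 1 := by linarith
  have hen : energy (kickInit (-κ)) = 1 := energy_kickInit (by rw [neg_sq]; nlinarith)
  have hnorm : ‖kickInit (-κ) - delayInit‖ ≤ r :=
    (norm_kickInit_neg_sub_delayInit hκ0.le hκ1).trans (by linarith)
  have hfire := h _ hen hnorm
  have hq := (hdud 2 (right_mem_Icc.2 (by norm_num))).2.2.2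
  have h1 := (abs_sub_le_iff.1 hfire).2
  have h2 := (abs_le.1 hq).2
  linarith

/-! ## §2. The Gaussian sharpening: the dud pre-load is below `2ε²e^{-M}/√M`

On `[0,1]` the trigger, rotor and output of a trajectory with pre-load in `[-3ε²e^{-M}, 0]` are so
small that `a² ≥ 1 - ε² - 48e^{-M}` and the clock runs at rate `≥ ε(49/50)`: `G(u) ≥ (49/100)Mu²`.
The discounted seed integral over the cycle is then at most the Gaussian
`ε²e^{-M}(∫₀¹ e^{-(49/100)Mu²}du + e^{1/20 - (49/100)M}) ≤ (7/4)ε²e^{-M}/√M`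
(`integral_gaussian_Ioi`), so the cycle-end trigger is already negative at pre-load
`-2ε²e^{-M}/√M`: the dud needs only `2/√M` seeds (`= 2K⁻⁵` seeds on Tao's `M = K¹⁰`). -/

namespace NegKick

/-- Gaussian tail bound: `∫₀¹ e^{-λr²} dr ≤ √(π/λ)/2` (`λ > 0`). [folklore] -/
theorem integral_exp_neg_mul_sq_le {l : ℝ} (hl : 0 < l) :
    ∫ r in (0 : ℝ)..1, exp (-l * r ^ 2) ≤ Real.sqrt (π / l) / 2 := by
  rw [intervalIntegral.integral_of_le zero_le_one, ← integral_gaussian_Ioi l]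
  refine setIntegral_mono_set (integrable_exp_neg_mul_sq hl).integrableOn ?_ ?_
  · exact Filter.Eventually.of_forall fun x => (exp_pos _).le
  · exact Filter.Eventually.of_forall Ioc_subset_Ioi_self

/-- `√(π/λ)/2 ≤ (3/2)/√M` once `λ ≥ (49/100)M > 0`. [folklore] -/
theorem sqrt_pi_div_le {M l : ℝ} (hM : 0 < M) (hl : 49 / 100 * M ≤ l) :
    Real.sqrt (π / l) / 2 ≤ 3 / 2 / Real.sqrt M := by
  have hpi : π < 3.15 := Real.pi_lt_d2
  have hl0 : 0 < l := by linarith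
  have h1 : Real.sqrt (π / l) ≤ Real.sqrt (9 / M) := Real.sqrt_le_sqrt (by
    rw [div_le_div_iff₀ hl0 hM]; nlinarith)
  have h2 : Real.sqrt (9 / M) = 3 / Real.sqrt M := by
    rw [Real.sqrt_div' 9 hM.le, show (9 : ℝ) = 3 ^ 2 by norm_num, Real.sqrt_sq (by norm_num)]
  rw [h2] at h1
  calc Real.sqrt (π / l) / 2 ≤ 3 / Real.sqrt M / 2 := by linarith
    _ = 3 / 2 / Real.sqrt M := by ring

/-- `e^{1/20 - λ} ≤ (1/4)/√M` once `λ ≥ (49/100)M` and `M ≥ 80`. [folklore] -/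
theorem exp_sub_le {M l : ℝ} (hM : 80 ≤ M) (hl : 49 / 100 * M ≤ l) :
    exp (1 / 20 - l) ≤ 1 / 4 / Real.sqrt M := by
  have hM0 : 0 < M := by linarith
  have hsq : Real.sqrt M ≤ M := by rw [Real.sqrt_le_left (by linarith)]; nlinarith
  have hsq0 : 0 < Real.sqrt M := Real.sqrt_pos.2 hM0
  -- e^{(12/25)M} ≥ (6M/25)² ≥ M²/18
  have h24 : 6 / 25 * M ≤ exp (6 / 25 * M) := by linarith [Real.add_one_le_exp (6 / 25 * M)]
  have h48 : M ^ 2 / 18 ≤ exp (12 / 25 * M) := by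
    have : exp (12 / 25 * M) = exp (6 / 25 * M) * exp (6 / 25 * M) := by rw [← exp_add]; ring_nf
    rw [this]; nlinarith [exp_pos (6 / 25 * M)]
  have he20 : exp (1 / 20 : ℝ) ≤ 11 / 10 := by
    have h := Real.abs_exp_sub_one_sub_id_le (x := 1 / 20) (by rw [abs_le]; constructor <;> norm_num)
    have := (abs_le.1 h).2
    nlinarith
  have hexp : exp (1 / 20 - l) ≤ 11 / 10 * (18 / M ^ 2) := by
    rw [exp_sub, div_eq_mul_inv]
    refine mul_le_mul he20 ?_ (inv_pos.2 (exp_pos _)).le (by norm_num)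
    rw [inv_le_comm₀ (exp_pos _) (by positivity)]
    calc (18 / M ^ 2)⁻¹ = M ^ 2 / 18 := by rw [inv_div]
      _ ≤ exp (12 / 25 * M) := h48
      _ ≤ exp l := exp_le_exp.2 (by linarith)
  refine hexp.trans ?_
  rw [le_div_iff₀ hsq0]
  calc 11 / 10 * (18 / M ^ 2) * Real.sqrt M ≤ 11 / 10 * (18 / M ^ 2) * M := by gcongr
    _ = 99 / 5 / M := by field_simp; ring
    _ ≤ 1 / 4 := by rw [div_le_iff₀ hM0]; linarith

variable {K M ε κ : ℝ} {X : ℝ → Fin 5 → ℝ}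

/-- `|c(t)| ≤ (-κ + ε²e^{-M})e^{M/2}` on `[0,1]` for a pre-load `κ ≤ 0`. [cite: Tao2016AveragedNS, §5.5] -/
theorem abs_c_le_one (hX : ∀ t, HasDerivAt X (delayCircuitWith K M ε (X t)) t)
    (h0 : X 0 = kickInit κ) (hκ : κ ^ 2 ≤ 1) (hκ0 : κ ≤ 0) (hM : 0 ≤ M) (hε : 0 < ε) {t : ℝ}
    (ht : t ∈ Icc (0 : ℝ) 1) : |X t 2| ≤ (-κ + ε ^ 2 * exp (-M)) * exp (M / 2) := by
  have hl := c_lower hX h0 hκ hκ0 hM hε ht.1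
  have hu := c_upper hX h0 hκ hκ0 hM hε ht.1
  have he : exp (M * t ^ 2 / 2) ≤ exp (M / 2) := by
    apply exp_le_exp.2
    have ht2 : t ^ 2 ≤ 1 := by nlinarith [ht.1, ht.2]
    have := mul_le_mul_of_nonneg_left ht2 hM
    linarith
  have he0 : 0 < exp (M * t ^ 2 / 2) := exp_pos _
  rw [abs_le]
  constructor
  · have : κ * exp (M / 2) ≤ κ * exp (M * t ^ 2 / 2) := mul_le_mul_of_nonpos_left he hκ0
    have h2 : 0 ≤ ε ^ 2 * exp (-M) * exp (M / 2) := by positivity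
    nlinarith
  · have h1 : ε ^ 2 * exp (-M) * t * exp (M * t ^ 2 / 2) ≤ ε ^ 2 * exp (-M) * exp (M / 2) := by
      have : ε ^ 2 * exp (-M) * t ≤ ε ^ 2 * exp (-M) := by
        nlinarith [ht.2, mul_pos (pow_pos hε 2) (exp_pos (-M))]
      exact mul_le_mul this he he0.le (by positivity)
    have h2 : 0 ≤ -κ * exp (M / 2) := by nlinarith [exp_pos (M / 2)]
    nlinarith

/-- The energy identity solved for `a²`. [cite: Tao2016AveragedNS, §5.5] -/
theorem a_sq_eq (hX : ∀ t, HasDerivAt X (delayCircuitWith K M ε (X t)) t)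
    (h0 : X 0 = kickInit κ) (hκ : κ ^ 2 ≤ 1) (t : ℝ) :
    X t 0 ^ 2 = 1 - X t 1 ^ 2 - X t 2 ^ 2 - X t 3 ^ 2 - X t 4 ^ 2 := by
  have h := kickW_energy hX h0 hκ t
  rw [energy, Fin.sum_univ_five] at h
  linarith

/-- **The clock's linear floor on `[0,1]`**: if `a² ≥ 1 - η₁` and `ε⁻¹Mc² ≤ εη₂` on `[0,1]` then
`b(r) ≥ ε(1 - η₁ - η₂)r` there. [cite: Tao2016AveragedNS, §5.5 (5.5) b-equation] -/
theorem b_ge_linear (hX : ∀ t, HasDerivAt X (delayCircuitWith K M ε (X t)) t)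
    (h0 : X 0 = kickInit κ) (hε : 0 < ε) {η₁ η₂ : ℝ}
    (ha : ∀ r ∈ Icc (0 : ℝ) 1, 1 - η₁ ≤ X r 0 ^ 2)
    (hc : ∀ r ∈ Icc (0 : ℝ) 1, ε⁻¹ * M * X r 2 ^ 2 ≤ ε * η₂) {r : ℝ} (hr : r ∈ Icc (0 : ℝ) 1) :
    ε * (1 - η₁ - η₂) * r ≤ X r 1 := by
  have hmono := Thm53.monotoneOn_sub_of_le_deriv (s := Icc (0 : ℝ) 1) (f := fun s => X s 1)
    (φ := fun _ => ε * (1 - η₁ - η₂)) (Φ := fun u => ε * (1 - η₁ - η₂) * u) (convex_Icc 0 1)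
    (fun u _ => (KickW.hasDerivAt_bcd hX u).1)
    (fun u _ => by simpa using (hasDerivAt_id u).const_mul (ε * (1 - η₁ - η₂)))
    (fun u hu => by
      have h1 := ha u hu
      have h2 := hc u hu
      have h3 : ε * (1 - η₁) ≤ ε * X u 0 ^ 2 := mul_le_mul_of_nonneg_left h1 hε.le
      linarith)
  have h := hmono (left_mem_Icc.2 zero_le_one) hr hr.1
  simp only [kick_init_b h0, mul_zero, sub_zero] at h
  linarith

/-- **The clock integral's quadratic floor on `[0,1]`**: if `b(r) ≥ ερr` on `[0,1]` then
`G(u) ≥ ρMu²/2` there. [folklore] -/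
theorem clockInt_ge (hX : ∀ t, HasDerivAt X (delayCircuitWith K M ε (X t)) t) (hM : 0 ≤ M)
    (hε : 0 < ε) {ρ : ℝ} (hb : ∀ r ∈ Icc (0 : ℝ) 1, ε * ρ * r ≤ X r 1) {u : ℝ}
    (hu : u ∈ Icc (0 : ℝ) 1) : ρ * M * u ^ 2 / 2 ≤ clockInt ε M X u := by
  have hmono := Thm53.monotoneOn_sub_of_le_deriv (s := Icc (0 : ℝ) 1) (f := clockInt ε M X)
    (φ := fun r => ρ * M * r) (Φ := fun r => ρ * M * r ^ 2 / 2) (convex_Icc 0 1)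
    (fun r _ => hasDerivAt_clockInt hX r)
    (fun r _ => by
      have := ((hasDerivAt_id r).pow 2).const_mul (ρ * M) |>.div_const 2
      refine this.congr_deriv ?_
      simp; ring)
    (fun r hr => by
      have h1 := mul_le_mul_of_nonneg_left (hb r hr) (show 0 ≤ ε⁻¹ * M by positivity)
      have : ε⁻¹ * M * (ε * ρ * r) = ρ * M * r := by field_simp
      linarith)
  have h := hmono (left_mem_Icc.2 zero_le_one) hu hu.1
  simp only [clockInt_zero] at h
  norm_num at h
  linarith

/-- **Sharp endpoint bound.** With `b ≥ -β` on `[0,2]` and `G(u) ≥ λu²` on `[0,1]` (`λ ≥ 0`):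
`c(2)e^{-G(2)} ≤ c(0) + ε²e^{-M}(∫₀¹ e^{-λr²}dr + e^{2ε⁻¹Mβ - λ})` (any real `λ`).
[cite: Tao2016AveragedNS, §5.5 proof of Theorem 5.3] -/
theorem disc_two_le_sharp (hX : ∀ t, HasDerivAt X (delayCircuitWith K M ε (X t)) t)
    (h0 : X 0 = kickInit κ) (hκ : κ ^ 2 ≤ 1) (hM : 0 ≤ M) (hε : 0 < ε) {β l : ℝ}
    (hb : ∀ u ∈ Icc (0 : ℝ) 2, -β ≤ X u 1)
    (hG : ∀ u ∈ Icc (0 : ℝ) 1, l * u ^ 2 ≤ clockInt ε M X u) :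
    X 2 2 * exp (-clockInt ε M X 2) ≤
      κ + ε ^ 2 * exp (-M) * (∫ r in (0 : ℝ)..1, exp (-l * r ^ 2)) +
        ε ^ 2 * exp (-M) * exp (2 * (ε⁻¹ * M * β) - l) := by
  set s : ℝ := ε ^ 2 * exp (-M) with hs
  have hs0 : 0 ≤ s := by positivity
  have hβ0 : 0 ≤ β := by
    have := hb 0 (left_mem_Icc.2 (by norm_num))
    rw [kick_init_b h0] at this
    linarith
  have hβ' : 0 ≤ ε⁻¹ * M * β := by positivity
  -- piece 1: [0,1] against the Gaussian primitive
  have hcont : Continuous fun r : ℝ => exp (-l * r ^ 2) := by fun_prop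
  have hanti1 := Thm53.antitoneOn_sub_of_deriv_le (s := Icc (0 : ℝ) 1)
    (f := fun u => X u 2 * exp (-clockInt ε M X u)) (φ := fun u => s * exp (-l * u ^ 2))
    (Φ := fun u => s * ∫ r in (0 : ℝ)..u, exp (-l * r ^ 2)) (convex_Icc 0 1)
    (fun u _ => hasDerivAt_disc hX u)
    (fun u _ => ((hcont.integral_hasStrictDerivAt 0 u).hasDerivAt).const_mul s)
    (fun u hu => by
      have h1 := disc_deriv_le hX h0 hκ u
      have h2 : exp (-clockInt ε M X u) ≤ exp (-l * u ^ 2) :=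
        exp_le_exp.2 (by have := hG u hu; linarith)
      calc ε ^ 2 * exp (-M) * X u 0 ^ 2 * exp (-clockInt ε M X u)
          ≤ ε ^ 2 * exp (-M) * exp (-clockInt ε M X u) := h1
        _ ≤ s * exp (-l * u ^ 2) := by rw [hs]; exact mul_le_mul_of_nonneg_left h2 (by positivity))
  have hp1 := hanti1 (left_mem_Icc.2 zero_le_one) (right_mem_Icc.2 zero_le_one) zero_le_one
  simp only [clockInt_zero, neg_zero, exp_zero, mul_one, kick_init_c h0,
    intervalIntegral.integral_same, mul_zero, sub_zero] at hp1
  -- hp1 : X 1 2 * exp (-G 1) - s * ∫₀¹ ≤ κ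
  -- piece 2: [1,2] at constant rate
  set k : ℝ := s * exp (2 * (ε⁻¹ * M * β) - l) with hk
  have hGmono := clockFloor_monotoneOn hX hM hε hb
  have hG1 : l ≤ clockInt ε M X 1 := by simpa using hG 1 (right_mem_Icc.2 zero_le_one)
  have hanti2 := Thm53.antitoneOn_sub_of_deriv_le (s := Icc (1 : ℝ) 2)
    (f := fun u => X u 2 * exp (-clockInt ε M X u)) (φ := fun _ => k) (Φ := fun u => k * u)
    (convex_Icc 1 2) (fun u _ => hasDerivAt_disc hX u)
    (fun u _ => by simpa using (hasDerivAt_id u).const_mul k) (fun u hu => by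
      have h1 := disc_deriv_le hX h0 hκ u
      have h1mem : (1 : ℝ) ∈ Icc (0 : ℝ) 2 := ⟨by norm_num, by norm_num⟩
      have humem : u ∈ Icc (0 : ℝ) 2 := ⟨by linarith [hu.1], hu.2⟩
      have hfl := hGmono h1mem humem hu.1
      simp only at hfl
      have h2 : exp (-clockInt ε M X u) ≤ exp (2 * (ε⁻¹ * M * β) - l) := by
        apply exp_le_exp.2
        have : ε⁻¹ * M * β * (u - 1) ≤ 2 * (ε⁻¹ * M * β) := by nlinarith [hu.1, hu.2]
        nlinarith
      calc ε ^ 2 * exp (-M) * X u 0 ^ 2 * exp (-clockInt ε M X u)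
          ≤ ε ^ 2 * exp (-M) * exp (-clockInt ε M X u) := h1
        _ ≤ k := by rw [hk, hs]; exact mul_le_mul_of_nonneg_left h2 (by positivity))
  have hp2 := hanti2 (left_mem_Icc.2 (by norm_num)) (right_mem_Icc.2 (by norm_num)) (by norm_num)
  simp only at hp2
  -- hp2 : X 2 2 * exp (-G 2) - k * 2 ≤ X 1 2 * exp (-G 1) - k * 1
  rw [hk] at hp2
  rw [hs] at hp1 hp2 ⊢
  linarith

/-- The arithmetic of the standing hypotheses used in §6: `M ≥ 6000`, `e^{-M} ≤ 1/6001`,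
`ε² ≤ 1/1000`, `16Mε²e^{-M} ≤ 1/1000`, `50Mε³e^{2M} ≤ ε`. [folklore] -/
theorem negKick_params_sharp (hK : 2 * 20 ^ 42 * (Nat.factorial 42 : ℝ) + 16 ≤ K)
    (hML : 3000 * Real.log K ≤ M) (hMK : M ≤ K ^ 10) (hε : 0 < ε)
    (hεle : ε ≤ exp (-(10 * M)) / K ^ 100) :
    6000 ≤ M ∧ exp (-M) ≤ 1 / 6001 ∧ ε ^ 2 ≤ 1 / 1000 ∧ 16 * M * ε ^ 2 * exp (-M) ≤ 1 / 1000 ∧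
      50 * M * ε ^ 3 * exp (2 * M) ≤ ε := by
  obtain ⟨hK16, hM4, hε1, hs3, hsmall, -⟩ := negKick_params hK hML hMK hε hεle
  obtain ⟨hlog2, -, -⟩ := Thm53With.log_facts hK16
  have hM6000 : 6000 ≤ M := by linarith
  have hM0 : 0 < M := by linarith
  obtain ⟨-, hε6, -, hε18⟩ := Thm53With.eps_facts hK16 hM0 hMK hε hεle
  have hK1 : (1 : ℝ) ≤ K := by linarith
  have hexpM : exp (-M) ≤ 1 / 6001 := by
    rw [exp_neg, inv_le_comm₀ (exp_pos M) (by norm_num)]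
    have := Real.add_one_le_exp M
    simp only [one_div, inv_inv]
    linarith
  have hε2 : ε ^ 2 ≤ 1 / 1000 := hε6.trans (by
    apply one_div_le_one_div_of_le (by norm_num)
    have : (16 : ℝ) ^ 20 ≤ K ^ 20 := pow_le_pow_left₀ (by norm_num) hK16 20
    nlinarith)
  have h16 : 16 * M * ε ^ 2 * exp (-M) ≤ 1 / 1000 := by
    have h1 : exp (-M) ≤ 1 := by rw [exp_le_one_iff]; linarith
    have h2 : 16 * M * ε ^ 2 ≤ 16 * M * (exp (-(18 * M)) / (64 * M)) := by gcongr
    have h3 : 16 * M * (exp (-(18 * M)) / (64 * M)) = exp (-(18 * M)) / 4 := by field_simp; ring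
    have h4 : exp (-(18 * M)) ≤ 1 / 6001 := by
      refine (exp_le_exp.2 (by linarith : -(18 * M) ≤ -M)).trans hexpM
    calc 16 * M * ε ^ 2 * exp (-M) ≤ 16 * M * ε ^ 2 * 1 := by gcongr
      _ ≤ exp (-(18 * M)) / 4 := by linarith
      _ ≤ 1 / 1000 := by linarith
  have hβε : 50 * M * ε ^ 3 * exp (2 * M) ≤ ε := by
    -- 50Mε²e^{2M} ≤ (1/40)/M ≤ 1
    have h1 : 50 * M * ε ^ 2 * exp (2 * M) ≤ 1 := by
      have : 50 * M * ε ^ 2 * exp (2 * M) * (2 * M) = 100 * M ^ 2 * ε ^ 2 * exp (2 * M) := by ring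
      nlinarith [mul_nonneg (mul_nonneg (mul_nonneg (by norm_num : (0:ℝ) ≤ 50) hM0.le) (sq_nonneg ε)) (exp_pos (2 * M)).le]
    calc 50 * M * ε ^ 3 * exp (2 * M) = (50 * M * ε ^ 2 * exp (2 * M)) * ε := by ring
      _ ≤ 1 * ε := mul_le_mul_of_nonneg_right h1 hε.le
      _ = ε := one_mul ε
  exact ⟨hM6000, hexpM, hε2, h16, hβε⟩
set_option maxHeartbeats 400000 in -- buildfix (bf3-g30): 160k/180k FAIL, 200k PASS at accept time; line-neutral budget line
/-- **The clock's quadratic floor on `[0,1]` for a pre-load in `[-3ε²e^{-M}, 0]`** under the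
standing hypotheses: `G(u) ≥ (49/100)Mu²` — from `|c| ≤ 4ε²e^{-M/2}`, `|d|, |ã| ≤ 4e^{-M/2}`,
`|b| ≤ ε` on `[0,1]`, whence `a² ≥ 1 - ε² - 48e^{-M}` and `∂ₜb ≥ (49/50)ε`.
[cite: Tao2016AveragedNS, §5.5] -/
theorem clockInt_ge_unit (hK : 2 * 20 ^ 42 * (Nat.factorial 42 : ℝ) + 16 ≤ K)
    (hML : 3000 * Real.log K ≤ M) (hMK : M ≤ K ^ 10) (hε : 0 < ε)
    (hεle : ε ≤ exp (-(10 * M)) / K ^ 100) (hX : ∀ t, HasDerivAt X (delayCircuitWith K M ε (X t)) t)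
    (h0 : X 0 = kickInit (-κ)) (hκ0 : 0 ≤ κ) (hκ3 : κ ≤ 3 * (ε ^ 2 * exp (-M))) :
    ∀ u ∈ Icc (0 : ℝ) 1, 49 / 100 * M * u ^ 2 ≤ clockInt ε M X u := by
  obtain ⟨hK16, hM4, hε1, hs3, hsmall, -⟩ := negKick_params hK hML hMK hε hεle
  obtain ⟨hM6000, hexpM, hε2, h16, hβε⟩ := negKick_params_sharp hK hML hMK hε hεle
  have hM : 0 ≤ M := by linarith
  obtain ⟨s, hs⟩ : ∃ s : ℝ, s = ε ^ 2 * exp (-M) := ⟨_, rfl⟩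
  have hs0 : 0 < s := by rw [hs]; positivity
  have hκsq : (-κ) ^ 2 ≤ 1 := by rw [neg_sq]; nlinarith
  have hκneg : -κ ≤ 0 := by linarith
  obtain ⟨-, hb, -⟩ := negKick_trajectory hK hML hMK hε hεle hX h0 hκ0 hκ3
  -- |c| ≤ 4 s e^{M/2} on [0,1]
  have hc1 : ∀ t ∈ Icc (0 : ℝ) 1, |X t 2| ≤ 4 * s * exp (M / 2) := fun t ht => by
    have := abs_c_le_one hX h0 hκsq hκneg hM hε ht
    rw [neg_neg] at this
    refine this.trans ?_
    have : κ + ε ^ 2 * exp (-M) ≤ 4 * s := by rw [hs]; linarith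
    exact mul_le_mul_of_nonneg_right this (exp_pos _).le
  -- |d|, |e| ≤ 4 e^{-M/2} on [0,1]
  have hde1 : ∀ t ∈ Icc (0 : ℝ) 1, |X t 3| ≤ 4 * exp (-(M / 2)) ∧ |X t 4| ≤ 4 * exp (-(M / 2)) :=
    fun t ht => by
    obtain ⟨hd, he⟩ := de_le hX h0 hκsq hε (by positivity) hc1 ht
    have hC : (ε ^ 2)⁻¹ * (4 * s * exp (M / 2)) * t ≤ 4 * exp (-(M / 2)) := by
      have h1 : (ε ^ 2)⁻¹ * (4 * s * exp (M / 2)) = 4 * exp (-(M / 2)) := by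
        have hee : exp (-M) * exp (M / 2) = exp (-(M / 2)) := by rw [← exp_add]; ring_nf
        have hε2 : ε ^ 2 ≠ 0 := by positivity
        calc (ε ^ 2)⁻¹ * (4 * s * exp (M / 2)) = 4 * (exp (-M) * exp (M / 2)) := by
              rw [hs]; field_simp
          _ = 4 * exp (-(M / 2)) := by rw [hee]
      rw [h1]; nlinarith [ht.2, exp_pos (-(M / 2))]
    exact ⟨hd.trans hC, he.trans hC⟩
  -- a² ≥ 1 - ε² - 48 e^{-M} on [0,1]
  have hsqe : s ^ 2 * exp M ≤ exp (-M) := by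
    have h1 : s ^ 2 * exp M = ε ^ 4 * exp (-M) := by
      have hee : exp (-M) * exp (-M) * exp M = exp (-M) := by rw [← exp_add, ← exp_add]; ring_nf
      rw [hs]
      calc (ε ^ 2 * exp (-M)) ^ 2 * exp M = ε ^ 4 * (exp (-M) * exp (-M) * exp M) := by ring
        _ = ε ^ 4 * exp (-M) := by rw [hee]
    rw [h1]
    have : ε ^ 4 ≤ 1 := by nlinarith [sq_nonneg ε]
    nlinarith [exp_pos (-M)]
  have heM2 : exp (-(M / 2)) ^ 2 = exp (-M) := by rw [← Real.exp_nat_mul]; ring_nf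
  have heM2' : exp (M / 2) ^ 2 = exp M := by rw [← Real.exp_nat_mul]; ring_nf
  have ha : ∀ r ∈ Icc (0 : ℝ) 1, 1 - (ε ^ 2 + 48 * exp (-M)) ≤ X r 0 ^ 2 := fun r hr => by
    rw [a_sq_eq hX h0 hκsq r]
    have hbu : X r 1 ≤ ε * r := kickW_b_le hX h0 hκsq hM hε.le hr.1
    have hbl : -(50 * M * ε ^ 3 * exp (2 * M)) ≤ X r 1 := hb r ⟨hr.1, by linarith [hr.2]⟩
    have hb2 : X r 1 ^ 2 ≤ ε ^ 2 := by
      have h1 : X r 1 ≤ ε := by nlinarith [hr.2]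
      have h2 : -ε ≤ X r 1 := by linarith
      nlinarith
    have hc2 : X r 2 ^ 2 ≤ 16 * exp (-M) := by
      have h1 := hc1 r hr
      have h2 : X r 2 ^ 2 ≤ (4 * s * exp (M / 2)) ^ 2 := by
        rw [← sq_abs]; exact pow_le_pow_left₀ (abs_nonneg _) h1 2
      have h3 : (4 * s * exp (M / 2)) ^ 2 = 16 * (s ^ 2 * exp M) := by rw [← heM2']; ring
      rw [h3] at h2
      nlinarith
    obtain ⟨hd, he⟩ := hde1 r hr
    have hd2 : X r 3 ^ 2 ≤ 16 * exp (-M) := by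
      have : X r 3 ^ 2 ≤ (4 * exp (-(M / 2))) ^ 2 := by
        rw [← sq_abs]; exact pow_le_pow_left₀ (abs_nonneg _) hd 2
      rw [mul_pow, heM2] at this; linarith
    have he2 : X r 4 ^ 2 ≤ 16 * exp (-M) := by
      have : X r 4 ^ 2 ≤ (4 * exp (-(M / 2))) ^ 2 := by
        rw [← sq_abs]; exact pow_le_pow_left₀ (abs_nonneg _) he 2
      rw [mul_pow, heM2] at this; linarith
    linarith
  -- ε⁻¹ M c² ≤ ε (16 M ε² e^{-M})
  have hcM : ∀ r ∈ Icc (0 : ℝ) 1, ε⁻¹ * M * X r 2 ^ 2 ≤ ε * (16 * M * ε ^ 2 * exp (-M)) :=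
    fun r hr => by
    have h1 := hc1 r hr
    have h2 : X r 2 ^ 2 ≤ (4 * s * exp (M / 2)) ^ 2 := by
      rw [← sq_abs]; exact pow_le_pow_left₀ (abs_nonneg _) h1 2
    have h3 : (4 * s * exp (M / 2)) ^ 2 = 16 * ε ^ 4 * exp (-M) := by
      have : (4 * s * exp (M / 2)) ^ 2 = 16 * (s ^ 2 * exp M) := by rw [← heM2']; ring
      rw [this, hs]
      have hee : exp (-M) * exp (-M) * exp M = exp (-M) := by rw [← exp_add, ← exp_add]; ring_nf
      calc 16 * ((ε ^ 2 * exp (-M)) ^ 2 * exp M) = 16 * ε ^ 4 * (exp (-M) * exp (-M) * exp M) := by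
            ring
        _ = 16 * ε ^ 4 * exp (-M) := by rw [hee]
    rw [h3] at h2
    have h4 : ε⁻¹ * M * X r 2 ^ 2 ≤ ε⁻¹ * M * (16 * ε ^ 4 * exp (-M)) :=
      mul_le_mul_of_nonneg_left h2 (by positivity)
    have h5 : ε⁻¹ * M * (16 * ε ^ 4 * exp (-M)) = ε * (16 * M * ε ^ 2 * exp (-M)) := by
      field_simp
    linarith
  -- the clock floor on [0,1]: ρ = 1 - η₁ - η₂ ≥ 49/50
  obtain ⟨ρ, hρ⟩ : ∃ ρ : ℝ, ρ = 1 - (ε ^ 2 + 48 * exp (-M)) - 16 * M * ε ^ 2 * exp (-M) :=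
    ⟨_, rfl⟩
  have hρ49 : 49 / 50 ≤ ρ := by
    rw [hρ]
    have : 48 * exp (-M) ≤ 48 / 6001 := by linarith
    linarith
  have hblin : ∀ r ∈ Icc (0 : ℝ) 1, ε * ρ * r ≤ X r 1 := fun r hr => by
    have := b_ge_linear hX h0 hε ha hcM hr
    rw [hρ]; linarith [this]
  intro u hu
  have h1 := clockInt_ge hX hM hε hblin hu
  have hMu : 0 ≤ M * u ^ 2 := by positivity
  have h2 := mul_le_mul_of_nonneg_right hρ49 hMu
  linarith

/-- **The sharp trajectory estimate.** For a pre-load in `[-3ε²e^{-M}, 0]` under the standing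
hypotheses, the cycle-end discounted trigger is at most `-κ + (7/4)ε²e^{-M}/√M`.
[cite: Tao2016AveragedNS, §5.5] -/
theorem negKick_trajectory_sharp (hK : 2 * 20 ^ 42 * (Nat.factorial 42 : ℝ) + 16 ≤ K)
    (hML : 3000 * Real.log K ≤ M) (hMK : M ≤ K ^ 10) (hε : 0 < ε)
    (hεle : ε ≤ exp (-(10 * M)) / K ^ 100) (hX : ∀ t, HasDerivAt X (delayCircuitWith K M ε (X t)) t)
    (h0 : X 0 = kickInit (-κ)) (hκ0 : 0 ≤ κ) (hκ3 : κ ≤ 3 * (ε ^ 2 * exp (-M))) :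
    X 2 2 * exp (-clockInt ε M X 2) ≤ -κ + 7 / 4 * (ε ^ 2 * exp (-M)) / Real.sqrt M := by
  obtain ⟨-, hM4, -, hs3, hsmall, -⟩ := negKick_params hK hML hMK hε hεle
  obtain ⟨hM6000, -⟩ := negKick_params_sharp hK hML hMK hε hεle
  have hM : 0 ≤ M := by linarith
  have hM0 : 0 < M := by linarith
  have hκsq : (-κ) ^ 2 ≤ 1 := by rw [neg_sq]; nlinarith
  obtain ⟨-, hb, -⟩ := negKick_trajectory hK hML hMK hε hεle hX h0 hκ0 hκ3
  have hGl := clockInt_ge_unit hK hML hMK hε hεle hX h0 hκ0 hκ3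
  have hsharp := disc_two_le_sharp hX h0 hκsq hM hε hb hGl
  have hI : ∫ r in (0 : ℝ)..1, exp (-(49 / 100 * M) * r ^ 2) ≤ 3 / 2 / Real.sqrt M :=
    (integral_exp_neg_mul_sq_le (by positivity)).trans (sqrt_pi_div_le hM0 le_rfl)
  have hT : exp (2 * (ε⁻¹ * M * (50 * M * ε ^ 3 * exp (2 * M))) - 49 / 100 * M)
      ≤ 1 / 4 / Real.sqrt M := by
    have h1 : 2 * (ε⁻¹ * M * (50 * M * ε ^ 3 * exp (2 * M))) = 100 * M ^ 2 * ε ^ 2 * exp (2 * M) := by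
      field_simp; ring
    rw [h1]
    exact (exp_le_exp.2 (sub_le_sub_right hsmall _)).trans (exp_sub_le (by linarith) le_rfl)
  have hsq0 : 0 < Real.sqrt M := Real.sqrt_pos.2 hM0
  have hs0 : 0 ≤ ε ^ 2 * exp (-M) := by positivity
  have h1 := mul_le_mul_of_nonneg_left hI hs0
  have h2 := mul_le_mul_of_nonneg_left hT hs0
  have h3 : ε ^ 2 * exp (-M) * (3 / 2 / Real.sqrt M) + ε ^ 2 * exp (-M) * (1 / 4 / Real.sqrt M)
      = 7 / 4 * (ε ^ 2 * exp (-M)) / Real.sqrt M := by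
    field_simp; ring
  linarith only [hsharp, h1, h2, h3.le]

end NegKick

/-- **Below `2/√M` seeds the gate already stalls**: the cycle-end trigger is negative at every
pre-load `κ ∈ [2ε²e^{-M}/√M, 3ε²e^{-M}]`. [cite: Tao2016AveragedNS, Theorem 5.3] -/
theorem cycleEndTrigger_neg_of_ge (hK : 2 * 20 ^ 42 * (Nat.factorial 42 : ℝ) + 16 ≤ K)
    (hML : 3000 * Real.log K ≤ M) (hMK : M ≤ K ^ 10) (hε : 0 < ε)
    (hεle : ε ≤ exp (-(10 * M)) / K ^ 100) {κ : ℝ}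
    (hκ2 : 2 * (ε ^ 2 * exp (-M)) / Real.sqrt M ≤ κ) (hκ3 : κ ≤ 3 * (ε ^ 2 * exp (-M))) :
    cycleEndTrigger K M ε κ < 0 := by
  obtain ⟨-, hM4, -⟩ := negKick_params hK hML hMK hε hεle
  have hM0 : 0 < M := by linarith
  have hsq0 : 0 < Real.sqrt M := Real.sqrt_pos.2 hM0
  have hs : 0 < ε ^ 2 * exp (-M) := by positivity
  have hκ0 : 0 ≤ κ := le_trans (by positivity) hκ2
  set X : ℝ → Fin 5 → ℝ := fun s => delayFlowWith K M ε s (kickInit (-κ))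
  have h2 := NegKick.negKick_trajectory_sharp (X := X) hK hML hMK hε hεle
    (hasDerivAt_delayFlowWith K M ε _) (delayFlowWith_zero K M ε _) hκ0 hκ3
  have hq : 7 / 4 * (ε ^ 2 * exp (-M)) / Real.sqrt M < 2 * (ε ^ 2 * exp (-M)) / Real.sqrt M := by
    rw [div_lt_div_iff_of_pos_right hsq0]; nlinarith
  have hneg : X 2 2 * exp (-NegKick.clockInt ε M X 2) < 0 := by linarith
  have hpos : 0 < exp (-NegKick.clockInt ε M X 2) := exp_pos _
  have : X 2 2 < 0 := by
    by_contra h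
    have h' : 0 ≤ X 2 2 := le_of_not_gt h
    nlinarith [mul_nonneg h' hpos.le]
  simpa [cycleEndTrigger, X] using this

/-- **The negative-kick dud, sharp form.** Under the standing hypotheses there is a pre-load
`κ* ∈ (0, 2ε²e^{-M}/√M)` — `2/√M` seeds, i.e. `2K⁻⁵` seeds on Tao's `M = K¹⁰` — whose EXACT flow
line returns the trigger to zero at the end of the cycle and keeps `|d|, |ã| ≤ 6e^{-M}` on `[0,2]`.
[cite: Tao2016AveragedNS, Theorem 5.3] -/
theorem exists_negativeKick_dud_sharp (hK : 2 * 20 ^ 42 * (Nat.factorial 42 : ℝ) + 16 ≤ K)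
    (hML : 3000 * Real.log K ≤ M) (hMK : M ≤ K ^ 10) (hε : 0 < ε)
    (hεle : ε ≤ exp (-(10 * M)) / K ^ 100) :
    ∃ κ : ℝ, 0 < κ ∧ κ < 2 * (ε ^ 2 * exp (-M)) / Real.sqrt M ∧
      delayFlowWith K M ε 2 (kickInit (-κ)) 2 = 0 ∧
      ∀ t ∈ Icc (0 : ℝ) 2,
        delayFlowWith K M ε t (kickInit (-κ)) 2 ≤ 0 ∧
        -(3 * (ε ^ 2 * exp (-M))) ≤ delayFlowWith K M ε t (kickInit (-κ)) 2 ∧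
        |delayFlowWith K M ε t (kickInit (-κ)) 3| ≤ 6 * exp (-M) ∧
        |delayFlowWith K M ε t (kickInit (-κ)) 4| ≤ 6 * exp (-M) := by
  obtain ⟨-, hM4, -⟩ := negKick_params hK hML hMK hε hεle
  have hM1 : 1 ≤ Real.sqrt M := by
    rw [show (1 : ℝ) = Real.sqrt 1 by simp]; exact Real.sqrt_le_sqrt (by linarith)
  have hsq0 : 0 < Real.sqrt M := by linarith
  have hs : 0 ≤ ε ^ 2 * exp (-M) := by positivity
  have h23 : 2 * (ε ^ 2 * exp (-M)) / Real.sqrt M ≤ 3 * (ε ^ 2 * exp (-M)) := by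
    rw [div_le_iff₀ hsq0]; nlinarith
  exact exists_dud_of_cycleEndTrigger_neg hK hML hMK hε hεle (by positivity) h23
    (cycleEndTrigger_neg_of_ge hK hML hMK hε hεle le_rfl h23)

/-- **Datum radius below `2/√M` seeds.** [cite: Tao2016AveragedNS, Theorem 5.3] -/
theorem datum_radius_lt_sharp (hK : 2 * 20 ^ 42 * (Nat.factorial 42 : ℝ) + 16 ≤ K)
    (hML : 3000 * Real.log K ≤ M) (hMK : M ≤ K ^ 10) (hε : 0 < ε)
    (hεle : ε ≤ exp (-(10 * M)) / K ^ 100) {r : ℝ}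
    (h : ∀ p : Fin 5 → ℝ, energy p = 1 → ‖p - delayInit‖ ≤ r →
      |delayFlowWith K M ε 2 p 4 - 1| ≤ 1 / 2) :
    r < 2 * (ε ^ 2 * exp (-M)) / Real.sqrt M := by
  obtain ⟨-, hM4, -⟩ := negKick_params hK hML hMK hε hεle
  have hM1 : 1 ≤ Real.sqrt M := by
    rw [show (1 : ℝ) = Real.sqrt 1 by simp]; exact Real.sqrt_le_sqrt (by linarith)
  have hsq0 : 0 < Real.sqrt M := by linarith
  have hs : 0 ≤ ε ^ 2 * exp (-M) := by positivity
  have h23 : 2 * (ε ^ 2 * exp (-M)) / Real.sqrt M ≤ 3 * (ε ^ 2 * exp (-M)) := by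
    rw [div_le_iff₀ hsq0]; nlinarith
  exact datum_radius_lt_of_cycleEndTrigger_neg hK hML hMK hε hεle (by positivity) h23
    (cycleEndTrigger_neg_of_ge hK hML hMK hε hεle le_rfl h23) h

/-! ## §3. The cell's question (D)(4) at the seed scale, decided for `q ≤ 4`

SeedCancellation.lean decided the cell's question (D)(4) (`PseudoOrbitTransition q`: forcing budget
`ε²/K^q`) in the negative for every `q`, by cancelling the seed with a forcing of size `ε²e^{-M}`.
The natural re-scaled question puts the budget at the seed scale, `ε²e^{-M}/K^q`. The sharp dud
decides it for `q ≤ 4`, WITHOUT forcing: on Tao's `M = K¹⁰` the dud datum is `2K⁻⁵` seeds from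
(5.6) and does not fire. (`q ≥ 5`: undecided here; the numerics of the cell, job j054490, put the
dud at `≈ 1.2533 K⁻⁵` seeds — `1.25×` the `q = 5` budget, out of its reach — so `q = 5` is expected
to hold, tightly, and `q ≥ 5` is the live positive half.) -/

/-- The cell's question (D)(4) at the SEED scale, exponent `q`: every `δ`-pseudo-orbit of a member
(standing hypotheses) in the sup-ball of radius 2 on `[0,T]`, `T ≥ 2`, issued `δ₀`-close to (5.6),
with budget `δ₀ + δT ≤ ε²e^{-M}/K^q`, has fired with tolerance `1/4` at every time in `[2,T]`.
Typed cell question; DECIDED BELOW for `q ≤ 4`: false. [cite: Tao2016AveragedNS, Theorem 5.3] -/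
def PseudoOrbitTransitionSeed (q : ℕ) : Prop :=
  ∀ (K M ε δ δ₀ T : ℝ) (Y : ℝ → Fin 5 → ℝ),
    2 * 20 ^ 42 * (Nat.factorial 42 : ℝ) + 16 ≤ K → 3000 * Real.log K ≤ M → M ≤ K ^ 10 →
    0 < ε → ε ≤ Real.exp (-(10 * M)) / K ^ 100 → 2 ≤ T → 0 ≤ δ₀ → 0 ≤ δ →
    IsPseudoOrbit (delayCircuitWith K M ε) δ 2 T Y → ‖Y 0 - delayInit‖ ≤ δ₀ →
    δ₀ + δ * T ≤ ε ^ 2 * Real.exp (-M) / K ^ q →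
    ∀ t ∈ Icc 2 T, |Y t 4 - 1| ≤ 1 / 4 ∧ ∀ i : Fin 5, i ≠ 4 → |Y t i| ≤ 1 / 4

/-- The seed-scale question is weaker than (D)(4) (its budget is smaller). [folklore] -/
theorem PseudoOrbitTransition.seed {q : ℕ} (h : PseudoOrbitTransition q) :
    PseudoOrbitTransitionSeed q := by
  intro K M ε δ δ₀ T Y hK hML hMK hε hεle hT hδ₀ hδ hY h0 hb
  refine h K M ε δ δ₀ T Y hK hML hMK hε hεle hT hδ₀ hδ hY h0 (hb.trans ?_)
  have hKq : 0 < K ^ q := by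
    have : (0 : ℝ) ≤ 2 * 20 ^ 42 * (Nat.factorial 42 : ℝ) := by positivity
    exact pow_pos (by linarith) q
  rw [div_le_div_iff_of_pos_right hKq]
  have hM : 0 ≤ M := by
    have h16 : (16 : ℝ) ≤ K := by
      have : (0 : ℝ) ≤ 2 * 20 ^ 42 * (Nat.factorial 42 : ℝ) := by positivity
      linarith
    have := Real.log_nonneg (by linarith : (1 : ℝ) ≤ K)
    linarith
  have : Real.exp (-M) ≤ 1 := by rw [Real.exp_le_one_iff]; linarith
  nlinarith [sq_nonneg ε]

/-- Monotonicity in the exponent. [folklore] -/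
theorem PseudoOrbitTransitionSeed.mono {q q' : ℕ} (hq : q ≤ q') (h : PseudoOrbitTransitionSeed q) :
    PseudoOrbitTransitionSeed q' := by
  intro K M ε δ δ₀ T Y hK hML hMK hε hεle hT hδ₀ hδ hY h0 hb
  refine h K M ε δ δ₀ T Y hK hML hMK hε hεle hT hδ₀ hδ hY h0 (hb.trans ?_)
  have hK1 : (1 : ℝ) ≤ K := by
    have : (0 : ℝ) ≤ 2 * 20 ^ 42 * (Nat.factorial 42 : ℝ) := by positivity
    linarith
  exact div_le_div_of_nonneg_left (by positivity) (by positivity) (pow_le_pow_right₀ hK1 hq)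

/-- **(D)(4) at the seed scale fails for `q ≤ 4`** — by the sharp negative-kick dud on Tao's own
tuning `M = K¹⁰` (no forcing: `δ = 0`, `δ₀ = κ* < 2ε²e^{-M}K⁻⁵ ≤ ε²e^{-M}K^{-q}`).
[cite: Tao2016AveragedNS, Theorem 5.3] -/
theorem not_pseudoOrbitTransitionSeed_of_le_four {q : ℕ} (hq : q ≤ 4) :
    ¬ PseudoOrbitTransitionSeed q := by
  intro h
  set K : ℝ := 2 * 20 ^ 42 * (Nat.factorial 42 : ℝ) + 16 with hKdef
  have hB : (0 : ℝ) ≤ 2 * 20 ^ 42 * (Nat.factorial 42 : ℝ) := by positivity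
  have hK0 : 2 * 20 ^ 42 * (Nat.factorial 42 : ℝ) + 16 ≤ K := le_rfl
  have hK16 : (16 : ℝ) ≤ K := by rw [hKdef]; linarith
  have hK1 : (1 : ℝ) ≤ K := by linarith
  have hKpos : (0 : ℝ) < K := by linarith
  have hlogK : Real.log K ≤ K := (Real.log_le_sub_one_of_pos hKpos).trans (by linarith)
  have hbig : (3000 : ℝ) ≤ 2 * 20 ^ 42 * (Nat.factorial 42 : ℝ) :=
    calc (3000 : ℝ) ≤ 2 * 20 ^ 42 := by norm_num
      _ = 2 * 20 ^ 42 * 1 := (mul_one _).symm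
      _ ≤ 2 * 20 ^ 42 * (Nat.factorial 42 : ℝ) := by
        gcongr; exact_mod_cast Nat.succ_le_of_lt (Nat.factorial_pos 42)
  have hML : 3000 * Real.log K ≤ K ^ 10 :=
    calc 3000 * Real.log K ≤ 3000 * K := by gcongr
      _ ≤ K * K := by gcongr; linarith
      _ = K ^ 2 := by ring
      _ ≤ K ^ 10 := pow_le_pow_right₀ hK1 (by norm_num)
  set M : ℝ := K ^ 10 with hMdef
  set ε : ℝ := Real.exp (-(10 * M)) / K ^ 100 with hεdef
  have hε : 0 < ε := by positivity
  obtain ⟨κ, hκ0, hκlt, -, hdud⟩ :=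
    exists_negativeKick_dud_sharp hK0 hML le_rfl hε le_rfl
  obtain ⟨-, hM4, -, hs3, -, hexpM⟩ := negKick_params hK0 hML le_rfl hε le_rfl
  have hsqrtM : Real.sqrt M = K ^ 5 := by
    rw [hMdef, show (K ^ 10 : ℝ) = (K ^ 5) ^ 2 by ring, Real.sqrt_sq (by positivity)]
  -- the dud as a 0-pseudo-orbit
  set Y : ℝ → Fin 5 → ℝ := fun t => delayFlowWith K M ε t (kickInit (-κ)) with hYdef
  have hκ1 : κ ≤ 1 := by
    have : 2 * (ε ^ 2 * exp (-M)) / Real.sqrt M ≤ 3 * (ε ^ 2 * exp (-M)) := by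
      rw [hsqrtM, div_le_iff₀ (by positivity)]
      have : (1 : ℝ) ≤ K ^ 5 := one_le_pow₀ hK1
      nlinarith [mul_nonneg (sq_nonneg ε) (exp_pos (-M)).le]
    linarith
  have hκsq : (-κ) ^ 2 ≤ 1 := by rw [neg_sq]; nlinarith
  have hY : IsPseudoOrbit (delayCircuitWith K M ε) 0 2 2 Y :=
    kickW_isPseudoOrbit (hasDerivAt_delayFlowWith K M ε _) (delayFlowWith_zero K M ε _) hκsq 2
      (by norm_num)
  have h0 : ‖Y 0 - delayInit‖ ≤ κ := by
    simp only [hYdef, delayFlowWith_zero]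
    exact norm_kickInit_neg_sub_delayInit hκ0.le hκ1
  have hbud : κ + 0 * 2 ≤ ε ^ 2 * Real.exp (-M) / K ^ q := by
    have hKq : 2 * K ^ q ≤ K ^ 5 := by
      have h1 : K ^ q ≤ K ^ 4 := pow_le_pow_right₀ hK1 hq
      have h2 : K ^ 5 = K * K ^ 4 := by ring
      nlinarith [pow_pos hKpos 4]
    have : 2 * (ε ^ 2 * exp (-M)) / Real.sqrt M ≤ ε ^ 2 * Real.exp (-M) / K ^ q := by
      rw [hsqrtM, div_le_div_iff₀ (by positivity) (by positivity)]
      nlinarith [mul_nonneg (sq_nonneg ε) (exp_pos (-M)).le]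
    linarith
  have hfire := (h K M ε 0 κ 2 Y hK0 hML le_rfl hε le_rfl le_rfl hκ0.le le_rfl hY h0 hbud 2
    ⟨le_rfl, le_rfl⟩).1
  have hq4 := (hdud 2 (right_mem_Icc.2 (by norm_num))).2.2.2
  have h1 : 3 / 4 ≤ Y 2 4 := by
    have := (abs_sub_le_iff.1 hfire).2
    linarith
  have h6 : 6 * exp (-M) ≤ 6 / 50 := by linarith
  have h2 : delayFlowWith K M ε 2 (kickInit (-κ)) 4 ≤ 6 / 50 := ((abs_le.1 hq4).2).trans h6
  change 3 / 4 ≤ delayFlowWith K M ε 2 (kickInit (-κ)) 4 at h1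
  exact absurd (h1.trans h2) (by norm_num)

end Literature.Analysis.FluidPDE.Tao2016AveragedNS
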